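import Summits.Ventures.HodgeKum4.Statement
import Literature.Computation.KummerOrbifold.Certificate5
import Mathlib.Analysis.Complex.Basic
import HarnessLib

/-!
# Route KummerFixedLocus (`hodge-kum4`, rung H3) — L1 definitions: the orbifold-model hypothesis (MODEL_X)

Seat p1.  Two propositions consumed BY NAME by the conditional closer of L1
(`Theorems/KummerFixedLocusLefschetzGenerationKum4.lean`):

* `ModelCore Inv` (predicate on a submodule `Inv ⊆ H*(Y; ℂ)`) and **`KummerOrbifoldModelKum4`**
  (MODEL_X, `@[conjecture]`-tagged named hypothesis, a ROUTE ITEM candidate per director ruling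
  2026-08-25T23:57:53Z (2)): for `X` smooth projective of `Kum⁴`-type and `g` a Kummer translation
  frame, the `g`-invariant classes are identified — `ℂ`-linearly, injectively, ONTO the generated module
  `C₀ = modelSpace ℂ` of the certified `m = 5` Kummer orbifold model
  (`Literature/Computation/KummerOrbifold/Model5`) — compatibly with the degree operator, with the 17
  seeds having homogeneous preimages of degrees in `{0, 2, 3}` (`ω₀` = seed `16` of degree `2`), and with
  cup product by the preimage of seed `j+1` intertwined with `genOp j` (`j < 16`).  PRINT ingredients:
  Fu–Tian–Vial 2019 Thm. 1.4/1.5 (ring isomorphism `H*(K_{m-1}(A), ℂ) ≅ H*_{orb,dt}([A_0^m/𝔖_m])` with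
  Fantechi–Göttsche's product and discrete torsion), deformation invariance of `(H*, ∪, Aut₀)` over the
  `Kum⁴`-type moduli (Ehresmann; Boissière–Nieper-Wißkirchen–Sarti; Hassett–Tschinkel Thm. 2.1).  OURS
  (COMPUTED, why-might-fail): the engine `Computation/KummerOrbifold` implements that recipe (validated:
  Betti numbers, Fujiki relation `∫(X₀+tΔ)⁸ = 525(2-10t²)⁴`, `q(δ) = -10`, census g0/g2 agreement) and
  `C₀` is the whole invariant ring (`Certificate5.replay5` + the sl₂-lemma of HOME/p1/L1-PROVENANCE §E1).
* **`FrameComplementKum4`** (KERNEL-DERIVABLE, kept OUT of MODEL_X per the same ruling): the frame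
  invariants have a complement `N'` on which `h` (`N = 8`) and every `L_x`, `x ∈ H²`, vanish — the
  coinvariant kernel `𝒦_tot ⊆ H⁸` (Foster 2024: the translations act trivially off the middle degree;
  Maschke).  Seat p2's `KummerFixedLocusCoinvariantsLLVTrivial` / `…OrbitSpan` supply it.
-/

namespace Summit.Ventures.HodgeKum4

open CategoryTheory
open Literature.AlgebraicGeometry Literature.AlgebraicGeometry.Hyperkaehler
open Literature.AlgebraicGeometry.HodgeTheory
open Literature.AlgebraicTopology.SingularHomology
open Literature.Computation.KummerOrbifold Literature.Computation.Sparse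

universe u

/-- **The orbifold-model identification of a submodule `Inv ⊆ H*(Y; ℂ)`** (seat p1): an injective
`ℂ`-linear `φ : Inv → (ℕ →₀ ℂ)` with image the generated module `C₀ = modelSpace ℂ` of the certified
`Kum⁴` orbifold model, a degree-`2` class `x₀ ∈ Inv` mapped to the seed `ω₀` (number `16`), `φ`
intertwining the degree operator (`N = 8`) with `degOp`, every seed having a homogeneous preimage of
degree in `{0, 2, 3}`, and cup product by a preimage of seed `j+1` intertwined with `genOp j` (`j < 16`). -/
def ModelCore {Y : Type u} [TopologicalSpace Y] (Inv : Submodule ℂ (totalCohomology ℂ Y)) : Prop :=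
  ∃ (φ : Inv →ₗ[ℂ] (ℕ →₀ ℂ)) (x₀ : singularCohomology ℂ ℂ Y 2) (hx₀ : ofDegree ℂ Y 2 x₀ ∈ Inv),
    Function.Injective φ ∧ LinearMap.range φ = modelSpace ℂ ∧ φ ⟨_, hx₀⟩ = seedVec ℂ 16 ∧
    (∀ (y : totalCohomology ℂ Y) (hy : y ∈ Inv) (hhy : degreeOperator ℂ Y 8 y ∈ Inv),
      φ ⟨_, hhy⟩ = degOp ℂ (φ ⟨y, hy⟩)) ∧
    (∀ s : ℕ, ∃ k ∈ ({0, 2, 3} : Set ℕ), ∃ (x : singularCohomology ℂ ℂ Y k)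
      (hx : ofDegree ℂ Y k x ∈ Inv), φ ⟨_, hx⟩ = seedVec ℂ s) ∧
    (∀ j < 16, ∀ (x : totalCohomology ℂ Y) (hx : x ∈ Inv), φ ⟨x, hx⟩ = seedVec ℂ (j + 1) →
      ∀ (y : totalCohomology ℂ Y) (hy : y ∈ Inv) (hxy : totalCup ℂ Y x y ∈ Inv),
        φ ⟨_, hxy⟩ = genOp ℂ j (φ ⟨y, hy⟩))

/-- **MODEL_X (`Kum⁴`, frame form) — NAMED HYPOTHESIS / ROUTE ITEM CANDIDATE (seat p1).**  For every
smooth projective complex `X` of dimension `8` of `Kum⁴`-type and every Kummer translation frame `g`,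
the `g`-invariant classes `H*(X(ℂ); ℂ)^{g}` satisfy `ModelCore`: they ARE the generated module `C₀` of
the certified `m = 5` Kummer orbifold model, compatibly with degrees, seeds and the generator products.
PRINT: Fu–Tian–Vial 2019 Thm. 1.4/1.5, Fantechi–Göttsche 2003 Thm. 3.10, deformation invariance
(Ehresmann; BNWS 2011; Hassett–Tschinkel 2013 Thm. 2.1).  OURS (COMPUTED): the engine
`Literature/Computation/KummerOrbifold` is that recipe and `C₀` is the whole `A[5]`-invariant ring
(evidence in the module docstring).  Why it might fail: a convention slip in the engine (sign of the
discrete torsion, Gysin class, normal form) — every printed invariant checked so far agrees. -/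
@[conjecture] def KummerOrbifoldModelKum4 : Prop :=
  ∀ ⦃X : Motives.SchemeOver ℂ⦄ (g : (Fin 4 → ZMod 5) → (X ⟶ X)),
    Motives.IsSmoothProjective 8 X → IsOfGeneralizedKummerType 4 X → IsKummerTranslationFrame X g →
      ModelCore (frameInvariants X g)

/-- **Frame complement (KERNEL-DERIVABLE; Foster 2024 + Maschke, seat p2's coinvariant kernel `𝒦_tot`).**
For `X` smooth projective of `Kum⁴`-type with a Kummer translation frame `g`, the `g`-invariant classes
have a complement `N'` in `H*(X(ℂ); ℂ)` killed by the degree operator (`N = 8`, i.e. `N' ⊆ H⁸`) and by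
every Lefschetz operator `L_x`, `x ∈ H²(X(ℂ); ℂ)`. -/
def FrameComplementKum4 : Prop :=
  ∀ ⦃X : Motives.SchemeOver ℂ⦄ (g : (Fin 4 → ZMod 5) → (X ⟶ X)),
    Motives.IsSmoothProjective 8 X → IsOfGeneralizedKummerType 4 X → IsKummerTranslationFrame X g →
      ∃ N' : Submodule ℂ (totalCohomology ℂ (Motives.ComplexPoints X)),
        IsCompl (frameInvariants X g) N' ∧
        (∀ n ∈ N', degreeOperator ℂ (Motives.ComplexPoints X) 8 n = 0) ∧
        (∀ (x : complexBetti X 2), ∀ n ∈ N', totalLefschetz x n = 0)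

end Summit.Ventures.HodgeKum4
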